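import Literature.AlgebraicGeometry.Resolution.ProjectiveResolutionProofs
import Literature.AlgebraicGeometry.Resolution.BlowupSequencesStableCentres
import Literature.AlgebraicGeometry.Resolution.StableReducedSubschemeAction
import HarnessLib

/-!
# Equivariant embedded resolution from a self-induced principalization (Kollár 2007, 3.35 ⟹ 3.36 with §3.4.1)

Topic: `Literature/AlgebraicGeometry/Resolution`. Theorems only (no definition, no named fact).

J. Kollár, *Lectures on Resolution of Singularities* (2007), proof of Cor. 3.22 ∕ Thm. 3.36 from 3.35
(pp. 124–125, 132): the resolution of an embedded `Y ⊂ X` is the strict transform of `Y` at the first blow-up of a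
principalization of `𝓘_Y` whose centre passes through the generic point of (the strict transform of) `Y`; and
§3.4.1 (p. 121): «Functoriality of resolutions implies that any group action on `X` lifts to `X′`».

This file is the EQUIVARIANT form of the tree's extraction `IsMultipleBlowup.isEmbeddedTransform_or_isRegular`
(`EffectiveResolutionMarked.lean`) + `exists_isResolution_of_isEmbeddedTransform` (`ProjectiveResolutionProofs.lean`),
run over a blow-up SEQUENCE `s : CentreSeq X` (chosen blow-ups, so that the equation `s = (ρ g)^* s` delivered by
Kollár's functoriality 3.34.1 — `EquivariantOrderReduction.lean` — pins every centre):

* `exists_isResolution_subschemeι_of_isEmbeddedTransform` — the extraction with its witness EXPOSED: the resolution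
  is the reduced strict transform `(𝓘_{closure Y'})_red ↪ X'` (same proof as `exists_isResolution_of_isEmbeddedTransform`);
* `CentreSeq.exists_equivariant_embeddedTransform` — **the swallowing recursion with a group action**: along a
  resolution `s` of the marked ideal `(X, 𝓘, E, 1)` with `V(𝓘) = closure {ξ}` which is self-induced along an action
  `ρ` (`s = (ρ g)^* s`) compatible with an action `ρ₀` on the original base, some initial segment is an embedded
  transform of `closure {ξ₀}` whose reduced strict transform is regular AND carries a lifted action making the
  composite blow-down equivariant and stabilising the strict transform (peeling by
  `CentreSeq.centre_stable_of_cons_eq_comap`, lifting by `IsBlowup.liftAction`, stability by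
  `preimage_strictTransformStep_eq`);
* `CentreSeq.IsResolutionOf.exists_equivariant_resolution` — **for a closed immersion `ι : Y ↪ X` (`Y` integral,
  `X` locally Noetherian), a resolution `s` of `(X, 𝓘_Y, E, 1)` by blow-ups in regular centres with
  `s = (ρ g)^* s` for an action `ρ` of `G` on `X` stabilising `ι(Y)`: there are an embedded transform
  `σ' : X'' → X` of `ι(Y)`, a resolution of singularities `r : Ỹ → Y` from its reduced strict transform
  `j : Ỹ ↪ X''` (`r ≫ ι = j ≫ σ'`), and actions of `G` on `X''` and on `Ỹ` making `σ'`, `j` and `r ≫ ι` equivariant.**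
  With `IsEmbeddedTransform.isProjectiveOver` the resolution is projective when `X` is
  (`…exists_equivariant_resolution_isProjectiveOver`).

Route note: brick «B2» of the Kollár-free deck family (P-3′) for route `HodgeConjecture/Q8SymplecticPowers` (crux K1Q,
stmt-HodgeConjecture-24190): with `Kollar2007.exists_equivariant_markedOrderReduction` (B1) it yields an equivariant
projective resolution of any `G`-stable subvariety of a smooth projective `G`-variety in characteristic zero; what
remains for the deck family is the `Q₈`-equivariant smooth projective embedding of the generic model (B3) and
3.36 (2) «isomorphism over the regular locus» for this resolution (B4). Nothing here bears on HC.

## References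

* [Kollar2007] J. Kollár, Lectures on Resolution of Singularities (2007), proof of Cor. 3.22 (pp. 124–125),
  Thm. 3.36 (p. 132), §3.4.1 (p. 121).
* [BierstoneGrigorievMilmanWlodarczyk2011] E. Bierstone, D. Grigoriev, P. Milman, J. Włodarczyk, Effective Hironaka
  resolution and its complexity, Asian J. Math. 15 (2011), §3.3 (1)⇒(4) and Thm. 2.0.3.
-/

noncomputable section

open CategoryTheory CategoryTheory.Limits AlgebraicGeometry TopologicalSpace Topology

namespace Literature.AlgebraicGeometry.Resolution

universe u

/-! ## The extraction with its witness exposed -/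

open Scheme.IdealSheafData in
/-- **Embedded desingularization ⇒ resolution, with the witness exposed** (the statement of
`exists_isResolution_of_isEmbeddedTransform`, naming the resolution: the REDUCED strict transform
`(𝓘_{closure Y'})_red ↪ X'` maps to `Y` by a resolution of singularities `ρ` with `ρ ≫ ι = ι_{red} ≫ σ`). Proof
verbatim that of `exists_isResolution_of_isEmbeddedTransform`.
[cite: BierstoneGrigorievMilmanWlodarczyk2011, §3.3 (3)⇒(4) and Thm. 2.0.3] [cite: Kollar2007, proof of Cor. 3.22 (pp. 124–125)] -/
theorem exists_isResolution_subschemeι_of_isEmbeddedTransform {X Y X' : Scheme.{u}}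
    [IsLocallyNoetherian X] [IsIntegral Y] (ι : Y ⟶ X) [IsClosedImmersion ι] {T : Set X}
    (hT : ι (genericPoint Y) ∉ T) {σ : X' ⟶ X} {Y' : Set X'}
    (h : IsEmbeddedTransform (Set.range ι) T σ Y')
    (hreg : Scheme.IsRegular
      (vanishingIdeal (⟨closure Y', isClosed_closure⟩ : Closeds X')).subscheme) :
    ∃ ρ : (vanishingIdeal (⟨closure Y', isClosed_closure⟩ : Closeds X')).subscheme ⟶ Y,
      IsResolution ρ ∧
        ρ ≫ ι = (vanishingIdeal (⟨closure Y', isClosed_closure⟩ : Closeds X')).subschemeι ≫ σ := by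
  classical
  -- `ι(Y)` is the closure of the image `ξ` of the generic point of `Y`
  set ξ : X := ι (genericPoint Y) with hξdef
  have hgen : IsGenericPoint ξ (Set.range ι) := by
    have := (genericPoint_spec Y).image ι.continuous
    rwa [Set.image_univ, ι.isClosedEmbedding.isClosed_range.closure_eq] at this
  have hYξ : Set.range ι = closure {ξ} := hgen.symm
  rw [hYξ] at h
  obtain ⟨hσ, V, hTV, hiso, ξ', hξ', hY'⟩ := h.isProper_and_exists stacks02NS_holds hT
  -- the strict transform `Z = closure {ξ'}` and its reduced structure `Yt`
  set Z : Closeds X' := ⟨closure Y', isClosed_closure⟩ with hZdef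
  have hZ : (Z : Set X') = closure {ξ'} := by
    change closure Y' = closure {ξ'}
    rw [hY', closure_closure]
  let j := (vanishingIdeal Z).subschemeι
  haveI : IsIntegral (vanishingIdeal Z).subscheme :=
    isIntegral_subscheme_vanishingIdeal Z (hZ ▸ isIrreducible_singleton.closure)
  have hrange : Set.range j = closure {ξ'} := by
    rw [range_subschemeι, coe_support_vanishingIdeal, hZ]
  -- `σ ∘ j` factors through `ι`
  have hker : ι.ker ≤ (j ≫ σ).ker := by
    have e1 : (j ≫ σ).ker = vanishingIdeal (.closure (σ '' (Z : Set X'))) := by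
      rw [← map_vanishingIdeal]
      rfl
    rw [e1, ← le_support_iff_le_vanishingIdeal]
    have e2 : (ι.ker.support : Set X) = Set.range ι := by
      rw [Scheme.Hom.support_ker, ι.isClosedEmbedding.isClosed_range.closure_eq]
    rw [← SetLike.coe_subset_coe, e2, Closeds.closure]
    change closure (σ '' (Z : Set X')) ⊆ Set.range ι
    rw [hYξ, hZ]
    refine closure_minimal ((image_closure_subset_closure_image σ.continuous).trans ?_)
      isClosed_closure
    rw [Set.image_singleton, hξ']
  let ρ : (vanishingIdeal Z).subscheme ⟶ Y := IsClosedImmersion.lift ι (j ≫ σ) hker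
  have hρ : ρ ≫ ι = j ≫ σ := IsClosedImmersion.lift_fac ι (j ≫ σ) hker
  have hρapp : ∀ y, ι (ρ y) = σ (j y) := fun y => by
    rw [← Scheme.Hom.comp_apply, hρ, Scheme.Hom.comp_apply]
  -- properness
  haveI : IsProper ρ := by
    have : IsProper (ρ ≫ ι) := by rw [hρ]; infer_instance
    exact MorphismProperty.of_postcomp (W := @IsProper) (W' := @IsSeparated) ρ ι inferInstance
      this
  -- the dense open `U = ι⁻¹ V` of `Y` and the point `y₀` of `Yt` over `ξ'`
  let U : Y.Opens := ι ⁻¹ᵁ V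
  have hξV : ξ ∈ V := hTV hT
  have hηU : genericPoint Y ∈ U := hξV
  obtain ⟨y₀, hy₀⟩ : ξ' ∈ Set.range j := by rw [hrange]; exact subset_closure rfl
  have hfibξ : σ ⁻¹' {ξ} = {ξ'} := by
    obtain ⟨x, -, huniq⟩ := existsUnique_preimage_of_isIso_morphismRestrict σ hiso hξV
    ext z
    simp only [Set.mem_preimage, Set.mem_singleton_iff]
    exact ⟨fun hz => (huniq z hz).trans (huniq ξ' hξ').symm, fun hz => hz ▸ hξ'⟩
  -- points of `X'` over `ι(Y) ∩ V` lie in the strict transform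
  have hover : ∀ x : X', σ x ∈ Set.range ι → σ x ∈ V → x ∈ closure {ξ'} := by
    intro x hx hxV
    rw [hYξ] at hx
    have := preimage_closure_inter_subset_of_isIso_morphismRestrict σ hiso {ξ} ⟨hx, hxV⟩
    rwa [hfibξ] at this
  have hbir : IsBirational ρ := by
    refine ⟨U, ?_, ?_, ?_⟩
    · -- `U` contains the generic point of `Y`
      have hd : Dense ({genericPoint Y} : Set Y) := by
        rw [dense_iff_closure_eq]; exact genericPoint_spec Y
      exact hd.mono (Set.singleton_subset_iff.mpr hηU)
    · -- `ρ⁻¹ U` contains the generic point `y₀` of `Yt`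
      have hgen' : closure ({y₀} : Set (vanishingIdeal Z).subscheme) = Set.univ := by
        rw [j.isClosedEmbedding.isInducing.closure_eq_preimage_closure_image, Set.image_singleton,
          hy₀, ← hrange, Set.preimage_range]
      have hd : Dense ({y₀} : Set (vanishingIdeal Z).subscheme) := by
        rw [dense_iff_closure_eq]; exact hgen'
      refine hd.mono (Set.singleton_subset_iff.mpr ?_)
      change ι (ρ y₀) ∈ V
      rw [hρapp, hy₀, hξ']
      exact hξV
    · -- over `U`, `ρ` is a surjective closed immersion onto a reduced scheme
      haveI : IsClosedImmersion (ρ ∣_ U) := by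
        have h1 : IsClosedImmersion ((j ≫ σ) ∣_ V) := by
          rw [morphismRestrict_comp]
          haveI := hiso
          exact (MorphismProperty.cancel_right_of_respectsIso @IsClosedImmersion _ _).mpr
            (IsZariskiLocalAtTarget.restrict (inferInstanceAs (IsClosedImmersion j)) _)
        rw [← hρ, morphismRestrict_comp] at h1
        exact MorphismProperty.of_postcomp (W := @IsClosedImmersion) (W' := @IsSeparated)
          (ρ ∣_ U) (ι ∣_ V) inferInstance h1
      haveI : Surjective (ρ ∣_ U) := by
        refine ⟨fun u => ?_⟩
        have hu : ι u.1 ∈ V := u.2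
        obtain ⟨x, hx, -⟩ := existsUnique_preimage_of_isIso_morphismRestrict σ hiso hu
        have hxZ : x ∈ Set.range j := by
          rw [hrange]
          exact hover x (hx ▸ Set.mem_range_self _) (hx ▸ hu)
        obtain ⟨y₁, rfl⟩ := hxZ
        have hρy₁ : ρ y₁ = u.1 := ι.isClosedEmbedding.injective (by rw [hρapp, hx])
        refine ⟨⟨y₁, show ρ y₁ ∈ U by rw [hρy₁]; exact u.2⟩, Subtype.ext ?_⟩
        rw [morphismRestrict_base_coe]
        exact hρy₁
      exact isIso_of_isClosedImmersion_of_surjective _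
  exact ⟨ρ, ⟨inferInstance, hbir, hreg⟩, hρ⟩

/-! ## The swallowing recursion, with a group action -/

namespace CentreSeq

variable {G : Type*} [Group G]

/-- **The first centre through the point over the generic point, equivariantly.** Let `X₀` be locally
Noetherian, `ξ₀ ∈ X₀`, `ρ₀` an action of `G` on `X₀`. Along the recursion: `φ : X → X₀` an embedded transform of
`closure {ξ₀}` over `{ξ₀}ᶜ` with strict transform `Y`, a point `ξ` over `ξ₀`, a marked ideal `M = (X, 𝓘, E, 1)` with
`ξ ∈ V(𝓘) ⊆ φ⁻¹(closure {ξ₀})`, a sequence `s` resolving `M` (admissible, final support empty), and an action `ρ`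
on `X` over `ρ₀` stabilising `Y` with `s = (ρ g)^* s`. THEN some initial segment of `s` extends `φ` to an embedded
transform `σ' : X'' → X₀` of `closure {ξ₀}` whose reduced strict transform is regular, carrying an action `ρ''`
over `ρ₀` stabilising the strict transform. (The recursion peels one `ρ`-stable centre at a time —
`centre_stable_of_cons_eq_comap`, `IsBlowup.liftAction` — and stops at the first centre through the point over
`ξ₀`, which is regular and swallows the strict transform, `IsEmbeddedTransform.isRegular_subscheme_of_centre`;
if no centre did, that point would survive in the empty final support.)
[cite: Kollar2007, proof of Cor. 3.22 (pp. 124–125) and §3.4.1 (p. 121)] -/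
theorem exists_equivariant_embeddedTransform {X₀ : Scheme.{u}} [IsLocallyNoetherian X₀] {ξ₀ : X₀}
    (ρ₀ : G →* Aut X₀) :
    ∀ {X : Scheme.{u}} (s : CentreSeq X) (φ : X ⟶ X₀) (Y : Set X),
      IsEmbeddedTransform (closure {ξ₀}) {ξ₀}ᶜ φ Y → ∀ ξ : X, φ ξ = ξ₀ →
      ∀ M : MarkedIdeal X, M.mult = 1 → ξ ∈ M.ideal.support →
      (M.ideal.support : Set X) ⊆ φ ⁻¹' closure {ξ₀} → s.IsAdmissibleFor M →
      (s.transformMarked M).support = ∅ →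
      ∀ ρ : G →* Aut X, (∀ g : G, (ρ g).hom ≫ φ = φ ≫ (ρ₀ g).hom) → (∀ g : G, (ρ g).hom ⁻¹' Y = Y) →
      (∀ g : G, s = s.comap (ρ g).hom) →
      ∃ (X'' : Scheme.{u}) (σ' : X'' ⟶ X₀) (Y' : Set X'') (ρ'' : G →* Aut X''),
        IsEmbeddedTransform (closure {ξ₀}) {ξ₀}ᶜ σ' Y' ∧
          Scheme.IsRegular (Scheme.IdealSheafData.vanishingIdeal
            (⟨closure Y', isClosed_closure⟩ : Closeds X'')).subscheme ∧
          (∀ g : G, (ρ'' g).hom ≫ σ' = σ' ≫ (ρ₀ g).hom) ∧ (∀ g : G, (ρ'' g).hom ⁻¹' Y' = Y')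
  | X, nil _, φ, Y, hET, ξ, hξ, M, hμ, hξM, hV, hs, hend, ρ, hρφ, hρY, hρs => by
    -- no blow-up left but the point over `ξ₀` survives in `V(𝓘) = supp M`: impossible
    exfalso
    have hempty : M.support = ∅ := hend
    rw [M.support_of_mult_eq_one hμ] at hempty
    have : ξ ∈ (M.ideal.support : Set X) := hξM
    rw [hempty] at this
    exact this
  | X, cons C rest, φ, Y, hET, ξ, hξ, M, hμ, hξM, hV, hs, hend, ρ, hρφ, hρY, hρs => by
    have hξ₀T : ξ₀ ∉ ({ξ₀}ᶜ : Set X₀) := by simp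
    obtain ⟨hσ, V, hTV, hiso, -⟩ := hET.isProper_and_exists stacks02NS_holds hξ₀T
    haveI : IsLocallyNoetherian X := LocallyOfFiniteType.isLocallyNoetherian φ
    obtain ⟨hCsupp, -, hC, hrest⟩ := (isAdmissibleFor_cons C rest M).mp hs
    -- the centre lies over `V(𝓘) ⊆ φ⁻¹(closure {ξ₀})`
    have hCV : (C.support : Set X) ⊆ φ ⁻¹' closure {ξ₀} :=
      (hCsupp.trans (M.support_subset_support_ideal (by omega))).trans hV
    have hCY : φ '' (C.support : Set X) ⊆ closure {ξ₀} := Set.image_subset_iff.mpr hCV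
    -- the centre is `ρ`-stable; the action lifts to the blow-up
    have hCstab : ∀ g : G, C.comap (ρ g).hom = C := fun g =>
      (centre_stable_of_cons_eq_comap (ρ g).hom (hρs g)).1
    by_cases hξC : ξ ∈ (C.support : Set X)
    · -- the centre passes through the point over `ξ₀`: stop here
      refine ⟨X, φ, Y, ρ, hET, ?_, hρφ, hρY⟩
      exact hET.isRegular_subscheme_of_centre hξ₀T C hC hCY ⟨ξ, hξC, hξ⟩
    · -- the centre misses the point over `ξ₀`, hence lies over `{ξ₀}ᶜ`; continue on `Bl_C X`
      have hξV : ξ₀ ∈ V := hTV hξ₀T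
      have hfib : ∀ x : X, φ x = ξ₀ → x = ξ := by
        obtain ⟨x₀, -, huniq⟩ := existsUnique_preimage_of_isIso_morphismRestrict φ hiso hξV
        intro x hx
        exact (huniq x hx).trans (huniq ξ hξ).symm
      have hT : φ '' (C.support : Set X) ⊆ {ξ₀}ᶜ := by
        rintro _ ⟨x, hxC, rfl⟩ (hx : φ x = ξ₀)
        exact hξC (hfib x hx ▸ hxC)
      -- the unique point over `ξ` (the blow-up is an isomorphism off its centre)
      let τ := blowup.π C
      have hτ : IsBlowup τ C := blowup.isBlowup C
      let Wc : X.Opens := ⟨(C.support : Set X)ᶜ, C.support.isClosed.isOpen_compl⟩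
      have hWc : IsIso (τ ∣_ Wc) := hτ.isIso_morphismRestrict disjoint_compl_left
      obtain ⟨ξ₁, hξ₁, -⟩ :=
        existsUnique_preimage_of_isIso_morphismRestrict τ hWc (y := ξ) hξC
      -- the lifted action on the blow-up
      let ρ₁ : G →* Aut (blowup C) := hτ.liftAction ρ hCstab
      have hρ₁τ : ∀ g : G, (ρ₁ g).hom ≫ τ = τ ≫ (ρ g).hom := fun g => hτ.liftAction_hom_comp ρ hCstab g
      have hρ₁s : ∀ g : G, rest = rest.comap (ρ₁ g).hom := by
        obtain ⟨hC', h'⟩ := eq_comap_liftAction_of_cons_eq_comap ρ hρs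
        exact h'
      -- recurse on the tail over the new base `Bl_C X`
      refine exists_equivariant_embeddedTransform ρ₀ rest (τ ≫ φ)
        (closure (τ ⁻¹' (Y \ (C.support : Set X))))
        (IsEmbeddedTransform.blowup hET C τ hτ hC hT) ξ₁
        (by rw [Scheme.Hom.comp_apply, hξ₁, hξ]) (M.transform τ C) (by simpa using hμ) ?_ ?_
        hrest hend ρ₁ ?_ ?_ hρ₁s
      · -- `ξ₁` is off the exceptional divisor, where `𝓘₁ = τ^* 𝓘`
        rw [MarkedIdeal.transform_ideal, hμ, controlledTransform, pow_one]
        refine mem_support_colon_of_not_mem_support ?_ ?_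
        · rw [Scheme.IdealSheafData.support_comap]
          show τ ξ₁ ∈ M.ideal.support
          rwa [hξ₁]
        · rw [Scheme.IdealSheafData.support_comap]
          show τ ξ₁ ∉ C.support
          rwa [hξ₁]
      · -- `V(𝓘₁) ⊆ τ⁻¹ V(𝓘) ⊆ (τ ≫ φ)⁻¹ closure {ξ₀}`
        intro x hx
        have hx' := Scheme.IdealSheafData.support_antitone
          (comap_le_controlledTransform τ C M.ideal M.mult) hx
        rw [Scheme.IdealSheafData.support_comap] at hx'
        have hx'' : φ (τ x) ∈ closure {ξ₀} := hV hx'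
        show (τ ≫ φ) x ∈ closure {ξ₀}
        rwa [Scheme.Hom.comp_apply]
      · intro g
        rw [← Category.assoc, hρ₁τ g, Category.assoc, hρφ g, Category.assoc]
      · intro g
        exact preimage_strictTransformStep_eq (ρ g).hom (hCstab g) τ (hρ₁τ g) (hρY g)

/-- **Equivariant resolution of an embedded `G`-stable subvariety from a self-induced resolution of its marked
ideal.** Let `X` be locally Noetherian, `ι : Y ↪ X` a closed immersion with `Y` integral, `E` any boundary, `s` a
resolution of the marked ideal `(X, 𝓘_Y, E, 1)` by blow-ups in regular centres (`CentreSeq.IsResolutionOf`), and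
`ρ` an action of `G` on `X` stabilising `ι(Y)` with `s = (ρ g)^* s` for all `g` (e.g. the value of a blow-up
sequence functor commuting with smooth morphisms, `Kollar2007.CommutesWithSmoothMorphisms.eq_comap_of_isIso`). Then
some initial segment `σ' : X'' → X` of `s` is an embedded transform of `ι(Y)` over `X ∖ {η}`, its reduced strict
transform `j : Ỹ ↪ X''` maps to `Y` by a RESOLUTION OF SINGULARITIES `r` with `r ≫ ι = j ≫ σ'`, and `G` acts on
`X''` and on `Ỹ` making `σ'`, `j`, hence `r ≫ ι`, equivariant.
[cite: Kollar2007, Thm. 3.36 with §3.4.1 (pp. 121, 132); proof of Cor. 3.22 (pp. 124–125)] -/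
theorem IsResolutionOf.exists_equivariant_resolution {X Y : Scheme.{u}} [IsLocallyNoetherian X]
    [IsIntegral Y] (ι : Y ⟶ X) [IsClosedImmersion ι] (E : List X.IdealSheafData) {s : CentreSeq X}
    (hs : s.IsResolutionOf ⟨ι.ker, E, 1⟩) (ρ : G →* Aut X) (hρs : ∀ g : G, s = s.comap (ρ g).hom)
    (hρY : ∀ g : G, (ρ g).hom ⁻¹' Set.range ι = Set.range ι) :
    ∃ (X'' : Scheme.{u}) (σ' : X'' ⟶ X) (Y' : Set X'') (ρ'' : G →* Aut X'')
      (Yt : Scheme.{u}) (j : Yt ⟶ X'') (r : Yt ⟶ Y) (ρt : G →* Aut Yt),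
      IsEmbeddedTransform (Set.range ι) {ι (genericPoint Y)}ᶜ σ' Y' ∧ IsClosedImmersion j ∧
        IsResolution r ∧ r ≫ ι = j ≫ σ' ∧
        (∀ g : G, (ρ'' g).hom ≫ σ' = σ' ≫ (ρ g).hom) ∧
        (∀ g : G, (ρt g).hom ≫ j = j ≫ (ρ'' g).hom) ∧
        (∀ g : G, (ρt g).hom ≫ r ≫ ι = (r ≫ ι) ≫ (ρ g).hom) := by
  set ξ : X := ι (genericPoint Y) with hξdef
  have hgen : IsGenericPoint ξ (Set.range ι) := by
    have := (genericPoint_spec Y).image ι.continuous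
    rwa [Set.image_univ, ι.isClosedEmbedding.isClosed_range.closure_eq] at this
  have hYξ : Set.range ι = closure {ξ} := hgen.symm
  have hsupp : ((ι.ker).support : Set X) = Set.range ι := by
    rw [Scheme.Hom.support_ker, ι.isClosedEmbedding.isClosed_range.closure_eq]
  have hξ : ξ ∈ (ι.ker).support := by
    rw [← SetLike.mem_coe, hsupp]
    exact Set.mem_range_self _
  have hV : ((ι.ker).support : Set X) ⊆ (𝟙 X) ⁻¹' closure {ξ} := by
    rw [hsupp, hYξ]; exact fun x hx => hx
  have hρY' : ∀ g : G, (ρ g).hom ⁻¹' closure {ξ} = closure {ξ} := by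
    intro g; rw [← hYξ]; exact hρY g
  obtain ⟨X'', σ', Y', ρ'', hET, hreg, hρ''σ, hρ''Y⟩ :=
    exists_equivariant_embeddedTransform (ξ₀ := ξ) ρ s (𝟙 X) (closure {ξ}) IsEmbeddedTransform.refl ξ rfl
      ⟨ι.ker, E, 1⟩ rfl hξ hV hs.1 hs.2 ρ (fun g => by simp) hρY' hρs
  rw [← hYξ] at hET
  -- the resolution from the reduced strict transform
  obtain ⟨r, hres, hr⟩ :=
    exists_isResolution_subschemeι_of_isEmbeddedTransform ι (T := {ξ}ᶜ) (by simp [hξdef]) hET hreg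
  -- the action restricts to the reduced strict transform
  have hZ : ∀ g : G, (ρ'' g).hom ⁻¹' ((⟨closure Y', isClosed_closure⟩ : Closeds X'') : Set X'') =
      (⟨closure Y', isClosed_closure⟩ : Closeds X'') := by
    intro g
    change (ρ'' g).hom ⁻¹' closure Y' = closure Y'
    change (ρ'' g).hom.homeomorph ⁻¹' closure Y' = closure Y'
    rw [(ρ'' g).hom.homeomorph.preimage_closure]
    exact congrArg closure (hρ''Y g)
  obtain ⟨ρt, hρt⟩ :=
    exists_action_restrict_vanishingIdeal_subscheme ρ'' (⟨closure Y', isClosed_closure⟩ : Closeds X'') hZ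
  refine ⟨X'', σ', Y', ρ'', _, _, r, ρt, hET, inferInstance, hres, hr, hρ''σ, hρt, fun g => ?_⟩
  rw [hr, ← Category.assoc, hρt g, Category.assoc, hρ''σ g, Category.assoc]

/-- The same with PROJECTIVITY: if moreover `X` is projective over a field `k` (structure morphism `p`), the
equivariant resolution `Ỹ` is projective over `k` for `r ≫ ι ≫ p` (blow-ups of projective schemes are
projective, `IsEmbeddedTransform.isProjectiveOver`; `Ỹ ↪ X''` is a closed immersion).
[cite: Kollar2007, Thm. 3.36 with §3.4.1 (pp. 121, 132)] [cite: Hartshorne1977, II Prop. 7.16 (c), p. 166] -/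
theorem IsResolutionOf.exists_equivariant_resolution_isProjectiveOver {k : Type u} [Field k]
    {X Y : Scheme.{u}} (p : X ⟶ Spec (.of k))
    (hX : Literature.AlgebraicGeometry.Motives.IsProjectiveOver (Over.mk p)) [IsIntegral Y] (ι : Y ⟶ X)
    [IsClosedImmersion ι] (E : List X.IdealSheafData) {s : CentreSeq X}
    (hs : s.IsResolutionOf ⟨ι.ker, E, 1⟩) (ρ : G →* Aut X) (hρs : ∀ g : G, s = s.comap (ρ g).hom)
    (hρY : ∀ g : G, (ρ g).hom ⁻¹' Set.range ι = Set.range ι) :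
    ∃ (Yt : Scheme.{u}) (r : Yt ⟶ Y) (ρt : G →* Aut Yt), IsResolution r ∧
      Literature.AlgebraicGeometry.Motives.IsProjectiveOver (Over.mk (r ≫ ι ≫ p)) ∧
      ∀ g : G, (ρt g).hom ≫ r ≫ ι = (r ≫ ι) ≫ (ρ g).hom := by
  haveI : IsLocallyNoetherian X := by
    haveI : IsProper p :=
      Literature.AlgebraicGeometry.Motives.IsProjectiveOver.isProper (X := Over.mk p) hX
    exact LocallyOfFiniteType.isLocallyNoetherian p
  obtain ⟨X'', σ', Y', ρ'', Yt, j, r, ρt, hET, hj, hres, hr, -, -, hequiv⟩ :=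
    hs.exists_equivariant_resolution ι E ρ hρs hρY
  have hproj := hET.isProjectiveOver p hX
  refine ⟨Yt, r, ρt, hres, ?_, hequiv⟩
  obtain ⟨n, e, he⟩ := hproj
  have hw : r ≫ ι ≫ p = j ≫ σ' ≫ p := by rw [← Category.assoc, hr, Category.assoc]
  refine ⟨n, Over.homMk (j ≫ e.left) ?_, ?_⟩
  · change (j ≫ e.left) ≫ (Literature.AlgebraicGeometry.Motives.projectiveSpace n k).hom = r ≫ ι ≫ p
    rw [Category.assoc, hw]
    congr 1
    exact Over.w e
  · change IsClosedImmersion (j ≫ e.left)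
    haveI := hj
    exact MorphismProperty.comp_mem @IsClosedImmersion j e.left hj he

end CentreSeq

end Literature.AlgebraicGeometry.Resolution

end
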